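import Summits.Ventures.HodgeRepro2.T5SU11KernelRowMonotone

/-!
# The diagonal of the kernel: derivative, monotonicity for `λ ≤ 2`, and the corner-away uniform bound

`K_λ(t, t) = −φ_λ(a_t) χ_λ(t) =: −D_λ(t)` (`kernel_diagonal_eq'`; row 620 has the form `−φ_λ² T_λ`). The Wronskian `sinh 2t (φ_λ χ_λ′ − φ_λ′ χ_λ) = −1` (row 3xx) turns the product rule into

* `hasDerivAt_kernel_diagonal` — **`(K_λ(t, t))′ = 1/sinh 2t − 2 φ_λ′(a_t) χ_λ(t)`**;
* `kernel_diagonal_strictMonoOn_of_le_two` — for `1 < λ ≤ 2` (`φ_λ′ ≤ 0`, row 2xx) **`t ↦ K_λ(t, t)` is strictly increasing on `(0, ∞)`**: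
  the diagonal `D_λ` is strictly decreasing from `+∞` (row 603) to `0` (row 622);
* `abs_kernel_le_diagonal_of_le` — **the corner-away uniform bound**: for `1 < λ ≤ 2` and `min(t, s) ≥ a > 0`, `|K_λ(t, s)| ≤ D_λ(a)`
  (row 637's domination by the diagonal at the smaller variable plus the monotonicity).

Nothing is claimed about (N).

Blind lane: Mathlib + the HodgeRepro2 prefix only; no sorry; axioms ⊆ {propext, Classical.choice,
Quot.sound}.
-/

namespace Summit.Ventures.HodgeRepro2.T5SU11KernelDiagonalMonotone

open Filter Topology MeasureTheory
open Set (Ioi)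
open T5SU11Cartan T5SU11SphericalFunction T5SU11SphericalBounds T5SU11SphericalDecay T5SU11SphericalMonotone
  T5SU11SphericalSolutionSpaceAll T5SU11ReductionOfOrder T5SU11RadialGreenKernel T5SU11KernelEnds
  T5SU11SphericalDecayFluxIdentity T5SU11KernelRowMonotone

section measure

variable [MeasurableSpace Circle] [BorelSpace Circle]

omit [BorelSpace Circle] in
/-- `K_λ(t, t) = −φ_λ(a_t) χ_λ(t)` (the product form; row 620's `kernel_diagonal_eq` is the `−φ_λ² T_λ` form). -/
theorem kernel_diagonal_eq' (lam t : ℝ) : sphGreenKernel lam t t = -(sph lam (hyp t) * sphDecay lam t) := by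
  rw [kernel_eq_of_ge lam le_rfl]

variable {lam : ℝ} (hlam : 1 < lam)

include hlam in
/-- **`(K_λ(t, t))′ = 1/sinh 2t − 2 φ_λ′(a_t) χ_λ(t)`** for `t > 0` (the product rule and the Wronskian `−1`). -/
theorem hasDerivAt_kernel_diagonal {t : ℝ} (ht : 0 < t) :
    HasDerivAt (fun t => sphGreenKernel lam t t)
      ((Real.sinh (2 * t))⁻¹ - 2 * deriv (fun t => sph lam (hyp t)) t * sphDecay lam t) t := by
  have hφ := hasDerivAt_sph_hyp_deriv lam t
  have hχ := hasDerivAt_sphDecay hlam ht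
  have h := (hφ.mul hχ).neg
  have hW := wronskian_sphDecay hlam ht
  have hs : Real.sinh (2 * t) ≠ 0 := (sinh_two_mul_pos ht).ne'
  have e : (Real.sinh (2 * t))⁻¹ - 2 * deriv (fun t => sph lam (hyp t)) t * sphDecay lam t
      = -(deriv (fun t => sph lam (hyp t)) t * sphDecay lam t + sph lam (hyp t) * sphDecay' lam t) := by
    field_simp
    linarith
  rw [e]
  refine h.congr_of_eventuallyEq (Eventually.of_forall fun u => ?_)
  exact kernel_diagonal_eq' lam u

include hlam in
/-- For `1 < λ ≤ 2`, **`t ↦ K_λ(t, t)` is strictly increasing on `(0, ∞)`** (the diagonal `φ_λ χ_λ` strictly decreases). -/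
theorem kernel_diagonal_strictMonoOn_of_le_two (h2 : lam ≤ 2) : StrictMonoOn (fun t => sphGreenKernel lam t t) (Ioi 0) := by
  refine strictMonoOn_of_deriv_pos (convex_Ioi 0) ?_ ?_
  · intro x hx
    exact (hasDerivAt_kernel_diagonal hlam hx).continuousAt.continuousWithinAt
  · intro x hx
    rw [interior_Ioi] at hx
    rw [(hasDerivAt_kernel_diagonal hlam hx).deriv]
    have hs : 0 < Real.sinh (2 * x) := sinh_two_mul_pos hx
    have hχ : 0 < sphDecay lam x := sphDecay_pos hlam hx
    have hφ' : deriv (fun t => sph lam (hyp t)) x ≤ 0 := by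
      rcases lt_or_eq_of_le h2 with hlt | heq
      · exact (deriv_sph_hyp_neg (by linarith) hlt hx).le
      · subst heq
        have : deriv (fun t => sph 2 (hyp t)) x = 0 := by
          have hconst : (fun t => sph 2 (hyp t)) = fun _ => (1 : ℝ) := by
            funext t
            exact T5SU11SphericalTwo.sph_two (hyp t)
          rw [hconst, deriv_const]
        rw [this]
    have : 0 < (Real.sinh (2 * x))⁻¹ := inv_pos.mpr hs
    nlinarith

include hlam in
/-- **The corner-away uniform bound** for `1 < λ ≤ 2`: `|K_λ(t, s)| ≤ φ_λ(a_a) χ_λ(a)` whenever `min(t, s) ≥ a > 0`. -/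
theorem abs_kernel_le_diagonal_of_le (h2 : lam ≤ 2) {a t s : ℝ} (ha : 0 < a) (hat : a ≤ t) (has : a ≤ s) :
    |sphGreenKernel lam t s| ≤ sph lam (hyp a) * sphDecay lam a := by
  have ht : 0 < t := lt_of_lt_of_le ha hat
  have hs : 0 < s := lt_of_lt_of_le ha has
  refine le_trans (abs_kernel_le_diagonal_min hlam ht hs) ?_
  have hmin : a ≤ min t s := le_min hat has
  have hmin0 : 0 < min t s := lt_min ht hs
  have hmono := (kernel_diagonal_strictMonoOn_of_le_two hlam h2).monotoneOn ha hmin0 hmin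
  rw [kernel_diagonal_eq', kernel_diagonal_eq'] at hmono
  linarith

end measure

end Summit.Ventures.HodgeRepro2.T5SU11KernelDiagonalMonotone
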